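import Mathlib.Analysis.SpecialFunctions.Log.Deriv
import Literature.Analysis.FluidPDE.CompressibleEulerPrimitiveForm
import Literature.Analysis.FunctionSpaces.TorusChainRule
import Literature.Analysis.FunctionSpaces.TorusCalculusProofs
import Literature.MathematicalPhysics.KineticTheory.HardSphereEuler

/-!
# `BlockGibbsToRelEntropy` (stmt-AtomisticToContinuum-13464), II: classical hard-sphere-Euler solutions in the analytic band conserve the thermodynamic entropy

Route JaynesSqueeze, support item `BlockGibbsToRelEntropy`, step (d) ("bookkeeping at the Euler-driven
reference"): Yau's relative entropy with respect to the local Gibbs law driven by the classical solution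
`U = (ρ, u, θ)` is, at leading order, `𝒮[U₀] − 𝒮[U_t] + ⟨U(t) − P̄_t, λ^E_t⟩`, where
`𝒮[U] = ∫ ρ s_σ(ρ, θ)`, `s_σ(r, ϑ) = 3/2 log ϑ − log r − f_ex(r σ³)` is the hard-sphere entropy per particle
(`f_ex = hsExcessFreeEnergy`). This file proves the classical half of that cancellation:

* `isClassicalEulerSolutionOn_of_isHardSphereEulerSolution` — a classical hard-sphere-Euler solution
  (`IsHardSphereEulerSolution σ T`) is, literally, a classical solution of the complete Euler system for the
  monatomic athermal law `EulerEOS.monatomicExcess ζ_σ f_σ`, `ζ_σ(r) = Z(rσ³)` (`Z = hsCompressibility`),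
  `f_σ(r) = f_ex(rσ³)` of `CompressibleEulerPrimitiveForm.lean`;
* `isPrimitiveEulerSolutionOn_of_isHardSphereEulerSolution` — hence a PRIMITIVE solution (continuity,
  Euler and temperature equations), provided the solution stays in a band `0 < ρσ³ < η₀` on which
  `f_ex` is smooth (the equation of state is only known to be smooth at small packing: the conversion of
  the tree, `isClassicalEulerSolutionOn_iff_primitive`, asks for smoothness on the whole quadrant and is
  re-run here locally, on an open set containing the range of `(ρ, θ)`);
* `entropy_balance` — the pointwise entropy balance `∂ₜ(ρ s_σ) + div(ρ s_σ u) = 0` (chain rule through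
  `(ρ, θ)`, continuity and temperature equations; the algebra closes by the DEFINITION
  `Z(η) = 1 + η f_ex'(η)` of the compressibility factor — Gibbs' relation `θ ds = de + p d(1/ρ)`);
* `integral_entropy_eq` — **conservation of the thermodynamic entropy**:
  `∫ ρ_t s_σ(ρ_t, θ_t) = ∫ ρ₀ s_σ(ρ₀, θ₀)` for `t ∈ [0, T)` (`∫ div = 0` on `𝕋³`, differentiation under `∫`,
  one-sided mean value theorem).

The smoothness hypothesis `ContDiffOn ℝ ∞ hsExcessFreeEnergy (Ioo 0 η₀)` is supplied by `HsEosLowDensity`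
(analytic `F = f_ex` on `[0, η₀)`), the band hypothesis `ρ_t(x) σ³ < η₀` on `[0, T)` by `DiluteSelfConsistency`.
Folklore (Courant–Friedrichs §§3, 7; Dafermos 2005 §3.3.6: smooth flows are isentropic along particle
paths). No definitions are introduced. prover-pitem-stmt-AtomisticToContinuum-13464-0.
-/

noncomputable section

namespace Summit.AtomisticToContinuum.HydrodynamicLimit.Theorems.JaynesSqueezeClosure

open MeasureTheory Filter Set Topology Function
open scoped ContDiff
open Literature.MathematicalPhysics.KineticTheory
open Literature.Analysis.FunctionSpaces Literature.Analysis.FunctionSpaces.Torus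
open Literature.Analysis.FluidPDE.CompressibleEuler

variable {σ η₀ T : ℝ} {ρ θ : ℝ → T3 → ℝ} {u : ℝ → T3 → V3}

/-! ### §1 Hard-sphere Euler solutions as classical / primitive Euler solutions -/

/-- **A classical hard-sphere-Euler solution is a classical solution of the complete Euler system** for the
monatomic athermal law `p = ρϑ Z(ρσ³)`, `e = 3ϑ/2` (`EulerEOS.monatomicExcess`), on the time set `[0, T)`:
the eight clauses coincide literally (`hsPressure σ ρ θ = ρ θ Z(ρσ³)`, `E = ρ(|u|²/2 + 3θ/2)`). [folklore] -/
theorem isClassicalEulerSolutionOn_of_isHardSphereEulerSolution (hE : IsHardSphereEulerSolution σ T ρ u θ) :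
    IsClassicalEulerSolutionOn
      (EulerEOS.monatomicExcess (fun r => hsCompressibility (r * σ ^ 3))
        (fun r => hsExcessFreeEnergy (r * σ ^ 3))) (Ico 0 T) ρ u θ where
  smooth_density := hE.smooth_density
  smooth_velocity := hE.smooth_velocity
  smooth_temperature := hE.smooth_temperature
  density_pos := hE.density_pos
  temperature_pos := hE.temperature_pos
  mass := hE.mass
  momentum := hE.momentum
  energy := hE.energy

/-- The open band `{0 < rσ³ < η₀} × {ϑ > 0}` of the `(ρ, θ)`-plane is open. [folklore] -/
theorem isOpen_band (σ η₀ : ℝ) :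
    IsOpen ({q : ℝ × ℝ | q.1 * σ ^ 3 ∈ Ioo 0 η₀ ∧ 0 < q.2}) := by
  have h1 : IsOpen {q : ℝ × ℝ | q.1 * σ ^ 3 ∈ Ioo 0 η₀} :=
    isOpen_Ioo.preimage (continuous_fst.mul continuous_const)
  have h2 : IsOpen {q : ℝ × ℝ | 0 < q.2} := isOpen_lt continuous_const continuous_snd
  exact h1.inter h2

/-- A constitutive function smooth on an open set containing the range of the jointly smooth fields
`(ρ, θ)` gives a jointly smooth field (local version of `isSmoothSpaceTimeOn_comp_quadrant`). [folklore] -/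
theorem isSmoothSpaceTimeOn_comp_of_mem {S : Set ℝ} {g : ℝ → ℝ → ℝ} {O : Set (ℝ × ℝ)}
    (hg : ContDiffOn ℝ ∞ (uncurry g) O) (hρ : IsSmoothSpaceTimeOn S ρ) (hθ : IsSmoothSpaceTimeOn S θ)
    (hmem : ∀ t ∈ S, ∀ x, (ρ t x, θ t x) ∈ O) :
    IsSmoothSpaceTimeOn S (fun t y => g (ρ t y) (θ t y)) := by
  have hpair : ContDiffOn ℝ ∞ (fun z => (stLift ρ z, stLift θ z)) (S ×ˢ (univ : Set (EuclideanSpace ℝ (Fin 3)))) :=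
    hρ.prodMk hθ
  have hmaps : MapsTo (fun z => (stLift ρ z, stLift θ z)) (S ×ˢ (univ : Set (EuclideanSpace ℝ (Fin 3)))) O := by
    rintro ⟨t, y⟩ ht
    exact hmem t ht.1 _
  exact hg.comp hpair hmaps

/-- The hard-sphere pressure `p(r, ϑ) = r ϑ Z(rσ³)`, `Z(η) = 1 + η f_ex'(η)`, is smooth on the band
`{0 < rσ³ < η₀} × {ϑ > 0}` when `f_ex` is smooth on `(0, η₀)`. [folklore] -/
theorem contDiffOn_pressure_band (hf : ContDiffOn ℝ ∞ hsExcessFreeEnergy (Ioo 0 η₀)) :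
    ContDiffOn ℝ ∞ (uncurry (EulerEOS.monatomicExcess (fun r => hsCompressibility (r * σ ^ 3))
        (fun r => hsExcessFreeEnergy (r * σ ^ 3))).p)
      {q : ℝ × ℝ | q.1 * σ ^ 3 ∈ Ioo 0 η₀ ∧ 0 < q.2} := by
  have hf' : ContDiffOn ℝ ∞ (deriv hsExcessFreeEnergy) (Ioo 0 η₀) :=
    hf.deriv_of_isOpen isOpen_Ioo (by simp)
  have hη : ContDiffOn ℝ ∞ (fun q : ℝ × ℝ => q.1 * σ ^ 3) {q : ℝ × ℝ | q.1 * σ ^ 3 ∈ Ioo 0 η₀ ∧ 0 < q.2} :=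
    (contDiffOn_fst.mul contDiffOn_const)
  have hmaps : MapsTo (fun q : ℝ × ℝ => q.1 * σ ^ 3) {q : ℝ × ℝ | q.1 * σ ^ 3 ∈ Ioo 0 η₀ ∧ 0 < q.2} (Ioo 0 η₀) :=
    fun q hq => hq.1
  have hZ : ContDiffOn ℝ ∞ (fun q : ℝ × ℝ => hsCompressibility (q.1 * σ ^ 3))
      {q : ℝ × ℝ | q.1 * σ ^ 3 ∈ Ioo 0 η₀ ∧ 0 < q.2} := by
    unfold hsCompressibility
    exact contDiffOn_const.add (hη.mul (hf'.comp hη hmaps))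
  have h : uncurry (EulerEOS.monatomicExcess (fun r => hsCompressibility (r * σ ^ 3))
      (fun r => hsExcessFreeEnergy (r * σ ^ 3))).p =
      fun q : ℝ × ℝ => q.1 * q.2 * hsCompressibility (q.1 * σ ^ 3) := by
    funext q; rfl
  rw [h]
  exact (contDiffOn_fst.mul contDiffOn_snd).mul hZ

/-- The hard-sphere entropy density `G(r, ϑ) = r (3/2 log ϑ − log r − f_ex(rσ³))` is smooth on the band
`{0 < rσ³ < η₀} × {ϑ > 0}` when `f_ex` is smooth on `(0, η₀)`. [folklore] -/
theorem contDiffOn_entropyDensity_band (hf : ContDiffOn ℝ ∞ hsExcessFreeEnergy (Ioo 0 η₀)) :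
    ContDiffOn ℝ ∞ (uncurry fun a b : ℝ =>
        a * (3 / 2 * Real.log b - Real.log a - hsExcessFreeEnergy (a * σ ^ 3)))
      {q : ℝ × ℝ | q.1 * σ ^ 3 ∈ Ioo 0 η₀ ∧ 0 < q.2} := by
  have hη : ContDiffOn ℝ ∞ (fun q : ℝ × ℝ => q.1 * σ ^ 3) {q : ℝ × ℝ | q.1 * σ ^ 3 ∈ Ioo 0 η₀ ∧ 0 < q.2} :=
    (contDiffOn_fst.mul contDiffOn_const)
  have hmaps : MapsTo (fun q : ℝ × ℝ => q.1 * σ ^ 3) {q : ℝ × ℝ | q.1 * σ ^ 3 ∈ Ioo 0 η₀ ∧ 0 < q.2} (Ioo 0 η₀) :=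
    fun q hq => hq.1
  have h1 : ∀ q ∈ {q : ℝ × ℝ | q.1 * σ ^ 3 ∈ Ioo 0 η₀ ∧ 0 < q.2}, q.1 ≠ 0 := by
    intro q hq h0
    have := hq.1.1
    rw [h0, zero_mul] at this
    exact lt_irrefl _ this
  have h2 : ∀ q ∈ {q : ℝ × ℝ | q.1 * σ ^ 3 ∈ Ioo 0 η₀ ∧ 0 < q.2}, q.2 ≠ 0 := fun q hq => hq.2.ne'
  have h : uncurry (fun a b : ℝ => a * (3 / 2 * Real.log b - Real.log a - hsExcessFreeEnergy (a * σ ^ 3))) =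
      fun q : ℝ × ℝ => q.1 * (3 / 2 * Real.log q.2 - Real.log q.1 - hsExcessFreeEnergy (q.1 * σ ^ 3)) := by
    funext q; rfl
  rw [h]
  exact contDiffOn_fst.mul (((contDiffOn_const.mul (contDiffOn_snd.log h2)).sub (contDiffOn_fst.log h1)).sub
    (hf.comp hη hmaps))

/-- **A classical hard-sphere-Euler solution in the band `ρσ³ < η₀` is a primitive solution** (continuity,
Euler and internal-energy equations) for the monatomic athermal law, when `f_ex` is smooth on `(0, η₀)` and
`σ > 0`: the flux identities of `CompressibleEulerPrimitiveForm.lean`, with the smoothness of the pressure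
field obtained on the band only. [folklore] -/
theorem isPrimitiveEulerSolutionOn_of_isHardSphereEulerSolution (hσ : 0 < σ)
    (hf : ContDiffOn ℝ ∞ hsExcessFreeEnergy (Ioo 0 η₀)) (hE : IsHardSphereEulerSolution σ T ρ u θ)
    (hband : ∀ t ∈ Ico 0 T, ∀ x, ρ t x * σ ^ 3 < η₀) :
    IsPrimitiveEulerSolutionOn
      (EulerEOS.monatomicExcess (fun r => hsCompressibility (r * σ ^ 3))
        (fun r => hsExcessFreeEnergy (r * σ ^ 3))) (Ico 0 T) ρ u θ := by
  set eos := EulerEOS.monatomicExcess (fun r => hsCompressibility (r * σ ^ 3))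
    (fun r => hsExcessFreeEnergy (r * σ ^ 3)) with heos
  have h := isClassicalEulerSolutionOn_of_isHardSphereEulerSolution hE
  have hS : UniqueDiffOn ℝ (Ico 0 T) := uniqueDiffOn_Ico 0 T
  have hmem : ∀ t ∈ Ico 0 T, ∀ x, (ρ t x, θ t x) ∈ {q : ℝ × ℝ | q.1 * σ ^ 3 ∈ Ioo 0 η₀ ∧ 0 < q.2} :=
    fun t ht x => ⟨⟨mul_pos (hE.density_pos t ht x) (pow_pos hσ 3), hband t ht x⟩, hE.temperature_pos t ht x⟩
  have hP : IsSmoothSpaceTimeOn (Ico 0 T) (fun t y => eos.p (ρ t y) (θ t y)) :=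
    isSmoothSpaceTimeOn_comp_of_mem (contDiffOn_pressure_band hf) hE.smooth_density hE.smooth_temperature hmem
  have hEn : IsSmoothSpaceTimeOn (Ico 0 T) (fun t y => eos.e (ρ t y) (θ t y)) := by
    have : (fun t y => eos.e (ρ t y) (θ t y)) = fun t y => (3 / 2 : ℝ) • θ t y := by
      funext t y; simp [heos, EulerEOS.monatomicExcess, smul_eq_mul]
    rw [this]
    exact hE.smooth_temperature.const_smul _
  have hc : ∀ t ∈ Ico 0 T, ∀ x, timeDerivWithin (Ico 0 T) ρ t x +
      (∑ i, u t x i * partialDeriv i (ρ t) x) + ρ t x * divergence (u t) x = 0 := fun t ht x => by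
    rw [← massFlux_identity h.smooth_density h.smooth_velocity ht x]
    exact h.mass t ht x
  have heu : ∀ t ∈ Ico 0 T, ∀ x, timeDerivWithin (Ico 0 T) u t x +
      (∑ i, u t x i • partialDeriv i (u t) x) +
      (ρ t x)⁻¹ • gradient (fun y => eos.p (ρ t y) (θ t y)) x = 0 := by
    intro t ht x
    have hρ0 : ρ t x ≠ 0 := (h.density_pos t ht x).ne'
    have key := momentumFlux_identity (p := fun s y => eos.p (ρ s y) (θ s y)) h.smooth_density
      h.smooth_velocity hS ht x hρ0
    rw [h.momentum t ht x, h.mass t ht x, zero_smul, add_zero] at key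
    exact (smul_eq_zero.1 key.symm).resolve_left hρ0
  refine ⟨h.smooth_density, h.smooth_velocity, h.smooth_temperature, h.density_pos,
    h.temperature_pos, hc, heu, fun t ht x => ?_⟩
  have hρ0 : ρ t x ≠ 0 := (h.density_pos t ht x).ne'
  have key := energyFlux_identity h.smooth_density h.smooth_velocity hP hEn hS ht x hρ0
  rw [h.energy t ht x, hc t ht x, heu t ht x, inner_zero_right, mul_zero, mul_zero, zero_add,
    zero_add] at key
  exact (mul_eq_zero.1 key.symm).resolve_left hρ0

/-! ### §2 The pointwise entropy balance -/

/-- Slice derivatives of the entropy density `G(a, b) = a (3/2 log b − log a − f_ex(aσ³))` at a point with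
`a ≠ 0`, `b ≠ 0` and `f_ex` differentiable at `aσ³`:
`∂_a G = (3/2 log b − log a − f_ex(aσ³)) − 1 − aσ³ f_ex'(aσ³)`, `∂_b G = 3a/(2b)`. [folklore] -/
theorem deriv_entropyDensity {a b : ℝ} (ha : a ≠ 0) (hb : b ≠ 0)
    (hf : DifferentiableAt ℝ hsExcessFreeEnergy (a * σ ^ 3)) :
    deriv (fun a' : ℝ => a' * (3 / 2 * Real.log b - Real.log a' - hsExcessFreeEnergy (a' * σ ^ 3))) a =
        (3 / 2 * Real.log b - Real.log a - hsExcessFreeEnergy (a * σ ^ 3)) - 1 -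
          a * σ ^ 3 * deriv hsExcessFreeEnergy (a * σ ^ 3) ∧
      deriv (fun b' : ℝ => a * (3 / 2 * Real.log b' - Real.log a - hsExcessFreeEnergy (a * σ ^ 3))) b =
        3 * a / (2 * b) := by
  constructor
  · have hcomp : HasDerivAt (fun a' : ℝ => hsExcessFreeEnergy (a' * σ ^ 3))
        (deriv hsExcessFreeEnergy (a * σ ^ 3) * σ ^ 3) a :=
      HasDerivAt.comp (h₂ := hsExcessFreeEnergy) (h := fun a' : ℝ => a' * σ ^ 3) a hf.hasDerivAt
        (hasDerivAt_mul_const (σ ^ 3))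
    have hin : HasDerivAt (fun a' : ℝ => 3 / 2 * Real.log b - Real.log a' - hsExcessFreeEnergy (a' * σ ^ 3))
        (0 - a⁻¹ - deriv hsExcessFreeEnergy (a * σ ^ 3) * σ ^ 3) a :=
      ((hasDerivAt_const a _).sub (Real.hasDerivAt_log ha)).sub hcomp
    have h : HasDerivAt (fun a' : ℝ => a' * (3 / 2 * Real.log b - Real.log a' - hsExcessFreeEnergy (a' * σ ^ 3)))
        (1 * (3 / 2 * Real.log b - Real.log a - hsExcessFreeEnergy (a * σ ^ 3)) +
          a * (0 - a⁻¹ - deriv hsExcessFreeEnergy (a * σ ^ 3) * σ ^ 3)) a :=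
      (hasDerivAt_id' a).mul hin
    rw [h.deriv]
    field_simp
    ring
  · have hin : HasDerivAt (fun b' : ℝ => 3 / 2 * Real.log b' - Real.log a - hsExcessFreeEnergy (a * σ ^ 3))
        (3 / 2 * b⁻¹ - 0 - 0) b :=
      (((Real.hasDerivAt_log hb).const_mul (3 / 2)).sub (hasDerivAt_const b _)).sub (hasDerivAt_const b _)
    rw [(hin.const_mul a).deriv]
    field_simp
    ring

/-- **The pointwise entropy balance of a classical hard-sphere-Euler solution in the band**:
`∂ₜ(ρ s_σ(ρ, θ)) + div(ρ s_σ(ρ, θ) u) = 0` on `[0, T) × 𝕋³`, `s_σ(r, ϑ) = 3/2 log ϑ − log r − f_ex(rσ³)`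
(chain rule through `(ρ, θ)`; continuity `Dₜρ = −ρ div u` and temperature equation
`Dₜθ = −(2/3) θ Z(ρσ³) div u`; the residual is `div u · ρ (1 + ρσ³ f_ex'(ρσ³) − Z(ρσ³)) = 0` by the
definition of `Z = hsCompressibility`). [folklore] -/
theorem entropy_balance (hσ : 0 < σ) (hf : ContDiffOn ℝ ∞ hsExcessFreeEnergy (Ioo 0 η₀))
    (hE : IsHardSphereEulerSolution σ T ρ u θ) (hband : ∀ t ∈ Ico 0 T, ∀ x, ρ t x * σ ^ 3 < η₀)
    {t : ℝ} (ht : t ∈ Ico 0 T) (x : T3) :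
    timeDerivWithin (Ico 0 T)
        (fun s y => ρ s y * (3 / 2 * Real.log (θ s y) - Real.log (ρ s y) - hsExcessFreeEnergy (ρ s y * σ ^ 3))) t x +
      divergence (fun y => (ρ t y * (3 / 2 * Real.log (θ t y) - Real.log (ρ t y) -
        hsExcessFreeEnergy (ρ t y * σ ^ 3))) • u t y) x = 0 := by
  have hprim := isPrimitiveEulerSolutionOn_of_isHardSphereEulerSolution hσ hf hE hband
  have hS : UniqueDiffOn ℝ (Ico (0 : ℝ) T) := uniqueDiffOn_Ico 0 T
  have hρ := hE.smooth_density
  have hθ := hE.smooth_temperature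
  have hρt : 0 < ρ t x := hE.density_pos t ht x
  have hθt : 0 < θ t x := hE.temperature_pos t ht x
  have hηt : ρ t x * σ ^ 3 ∈ Ioo 0 η₀ := ⟨mul_pos hρt (pow_pos hσ 3), hband t ht x⟩
  have hmem : ∀ s ∈ Ico 0 T, ∀ y, (ρ s y, θ s y) ∈ {q : ℝ × ℝ | q.1 * σ ^ 3 ∈ Ioo 0 η₀ ∧ 0 < q.2} :=
    fun s hs y => ⟨⟨mul_pos (hE.density_pos s hs y) (pow_pos hσ 3), hband s hs y⟩, hE.temperature_pos s hs y⟩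
  have hopen := isOpen_band σ η₀
  have hG := contDiffOn_entropyDensity_band (σ := σ) hf
  -- chain rules through `(ρ, θ)`
  have hdf : DifferentiableAt ℝ hsExcessFreeEnergy (ρ t x * σ ^ 3) :=
    (hf.differentiableOn (by simp)).differentiableAt (isOpen_Ioo.mem_nhds hηt)
  obtain ⟨hda, hdb⟩ := deriv_entropyDensity (σ := σ) (b := θ t x) hρt.ne' hθt.ne' hdf
  have hT := timeDerivWithin_comp₂
    (g := fun a b : ℝ => a * (3 / 2 * Real.log b - Real.log a - hsExcessFreeEnergy (a * σ ^ 3)))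
    hG hopen (by simp) hρ hθ hS ht x (hmem t ht x)
  have hX : ∀ i : Fin 3, partialDeriv i
      (fun y => ρ t y * (3 / 2 * Real.log (θ t y) - Real.log (ρ t y) - hsExcessFreeEnergy (ρ t y * σ ^ 3))) x =
      deriv (fun a' : ℝ => a' * (3 / 2 * Real.log (θ t x) - Real.log a' - hsExcessFreeEnergy (a' * σ ^ 3)))
          (ρ t x) * partialDeriv i (ρ t) x +
        deriv (fun b' : ℝ => ρ t x * (3 / 2 * Real.log b' - Real.log (ρ t x) -
          hsExcessFreeEnergy (ρ t x * σ ^ 3))) (θ t x) * partialDeriv i (θ t) x :=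
    fun i => partialDeriv_comp₂
      (g := fun a b : ℝ => a * (3 / 2 * Real.log b - Real.log a - hsExcessFreeEnergy (a * σ ^ 3)))
      hG hopen (by simp) ((hρ.isSmooth_slice ht).isContDiff (by simp))
      ((hθ.isSmooth_slice ht).isContDiff (by simp)) x (hmem t ht x) i
  -- the slice at time `t` is `C¹`, for the product rule of the divergence
  have hGfield : IsSmoothSpaceTimeOn (Ico 0 T)
      (fun s y => ρ s y * (3 / 2 * Real.log (θ s y) - Real.log (ρ s y) - hsExcessFreeEnergy (ρ s y * σ ^ 3))) :=
    isSmoothSpaceTimeOn_comp_of_mem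
      (g := fun a b : ℝ => a * (3 / 2 * Real.log b - Real.log a - hsExcessFreeEnergy (a * σ ^ 3)))
      hG hρ hθ hmem
  have hG1 : IsContDiff 1
      (fun y => ρ t y * (3 / 2 * Real.log (θ t y) - Real.log (ρ t y) - hsExcessFreeEnergy (ρ t y * σ ^ 3))) :=
    (hGfield.isSmooth_slice ht).isContDiff (by simp)
  have hu1 : IsContDiff 1 (u t) := (hE.smooth_velocity.isSmooth_slice ht).isContDiff (by simp)
  rw [show (fun s y => ρ s y * (3 / 2 * Real.log (θ s y) - Real.log (ρ s y) - hsExcessFreeEnergy (ρ s y * σ ^ 3))) =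
      fun s y => (fun a b : ℝ => a * (3 / 2 * Real.log b - Real.log a - hsExcessFreeEnergy (a * σ ^ 3)))
        (ρ s y) (θ s y) from rfl, hT, divergence_smul hG1 hu1 x]
  simp_rw [hX, hda, hdb]
  -- the two transport equations
  have hc := hprim.continuity t ht x
  have hte := hprim.temperature_eq hS ht x
  -- algebra
  set s₀ := 3 / 2 * Real.log (θ t x) - Real.log (ρ t x) - hsExcessFreeEnergy (ρ t x * σ ^ 3) with hs₀
  set A := s₀ - 1 - ρ t x * σ ^ 3 * deriv hsExcessFreeEnergy (ρ t x * σ ^ 3) with hA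
  set B := 3 * ρ t x / (2 * θ t x) with hB
  set D := divergence (u t) x with hD
  have hsum : ∑ i, u t x i * (A * partialDeriv i (ρ t) x + B * partialDeriv i (θ t) x) =
      A * ∑ i, u t x i * partialDeriv i (ρ t) x + B * ∑ i, u t x i * partialDeriv i (θ t) x := by
    rw [Finset.mul_sum, Finset.mul_sum, ← Finset.sum_add_distrib]
    exact Finset.sum_congr rfl fun i _ => by ring
  rw [hsum]
  have hρeq : timeDerivWithin (Ico 0 T) ρ t x + ∑ i, u t x i * partialDeriv i (ρ t) x = -(ρ t x * D) := by
    rw [hD]; linarith [hc]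
  have hθeq : timeDerivWithin (Ico 0 T) θ t x + ∑ i, u t x i * partialDeriv i (θ t) x =
      -(2 / 3 * (θ t x * hsCompressibility (ρ t x * σ ^ 3)) * D) := by
    rw [hD]; linarith [hte]
  have key : A * timeDerivWithin (Ico 0 T) ρ t x + B * timeDerivWithin (Ico 0 T) θ t x +
      (ρ t x * s₀ * D + (A * ∑ i, u t x i * partialDeriv i (ρ t) x + B * ∑ i, u t x i * partialDeriv i (θ t) x)) =
      A * (timeDerivWithin (Ico 0 T) ρ t x + ∑ i, u t x i * partialDeriv i (ρ t) x) +
        B * (timeDerivWithin (Ico 0 T) θ t x + ∑ i, u t x i * partialDeriv i (θ t) x) + ρ t x * s₀ * D := by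
    ring
  rw [key, hρeq, hθeq, hA, hB]
  unfold hsCompressibility
  field_simp
  ring

/-! ### §3 Conservation of the thermodynamic entropy -/

/-- **Classical hard-sphere-Euler solutions in the analytic band conserve the thermodynamic entropy.** For
`σ > 0`, `f_ex` smooth on `(0, η₀)`, a classical solution `(ρ, u, θ)` of the hard-sphere Euler system on
`[0, T) × 𝕋³` with `ρ σ³ < η₀` throughout, and `t ∈ [0, T)`:
`∫ ρ_t (3/2 log θ_t − log ρ_t − f_ex(ρ_t σ³)) = ∫ ρ₀ (3/2 log θ₀ − log ρ₀ − f_ex(ρ₀ σ³))`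
(integrate the pointwise balance `entropy_balance`: `∫ div = 0` on the torus, differentiation under the
integral, and a function with vanishing right derivative on `[0, t]` is constant). [folklore] -/
theorem integral_entropy_eq (hσ : 0 < σ) (hf : ContDiffOn ℝ ∞ hsExcessFreeEnergy (Ioo 0 η₀))
    (hE : IsHardSphereEulerSolution σ T ρ u θ) (hband : ∀ t ∈ Ico 0 T, ∀ x, ρ t x * σ ^ 3 < η₀)
    {t : ℝ} (ht : t ∈ Ico 0 T) :
    ∫ x, ρ t x * (3 / 2 * Real.log (θ t x) - Real.log (ρ t x) - hsExcessFreeEnergy (ρ t x * σ ^ 3)) =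
      ∫ x, ρ 0 x * (3 / 2 * Real.log (θ 0 x) - Real.log (ρ 0 x) - hsExcessFreeEnergy (ρ 0 x * σ ^ 3)) := by
  have hmem : ∀ s ∈ Ico 0 T, ∀ y, (ρ s y, θ s y) ∈ {q : ℝ × ℝ | q.1 * σ ^ 3 ∈ Ioo 0 η₀ ∧ 0 < q.2} :=
    fun s hs y => ⟨⟨mul_pos (hE.density_pos s hs y) (pow_pos hσ 3), hband s hs y⟩, hE.temperature_pos s hs y⟩
  have hGfield : IsSmoothSpaceTimeOn (Ico 0 T)
      (fun s y => ρ s y * (3 / 2 * Real.log (θ s y) - Real.log (ρ s y) - hsExcessFreeEnergy (ρ s y * σ ^ 3))) :=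
    isSmoothSpaceTimeOn_comp_of_mem
      (g := fun a b : ℝ => a * (3 / 2 * Real.log b - Real.log a - hsExcessFreeEnergy (a * σ ^ 3)))
      (contDiffOn_entropyDensity_band (σ := σ) hf) hE.smooth_density hE.smooth_temperature hmem
  have hderiv : ∀ s ∈ Ico 0 T, HasDerivWithinAt (fun s => ∫ x, ρ s x * (3 / 2 * Real.log (θ s x) -
      Real.log (ρ s x) - hsExcessFreeEnergy (ρ s x * σ ^ 3))) 0 (Ico 0 T) s := by
    intro s hs
    have h1 := hGfield.hasDerivWithinAt_integral (convex_Ico 0 T) hs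
    have h2 : ∫ x, timeDerivWithin (Ico 0 T) (fun s y => ρ s y * (3 / 2 * Real.log (θ s y) - Real.log (ρ s y) -
        hsExcessFreeEnergy (ρ s y * σ ^ 3))) s x = 0 := by
      have hpt : (fun x => timeDerivWithin (Ico 0 T) (fun s y => ρ s y * (3 / 2 * Real.log (θ s y) -
          Real.log (ρ s y) - hsExcessFreeEnergy (ρ s y * σ ^ 3))) s x) =
          fun x => -divergence (fun y => (ρ s y * (3 / 2 * Real.log (θ s y) - Real.log (ρ s y) -
            hsExcessFreeEnergy (ρ s y * σ ^ 3))) • u s y) x := by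
        funext x; have := entropy_balance hσ hf hE hband hs x; linarith
      rw [hpt, integral_neg, neg_eq_zero]
      exact integral_divergence_eq_zero_holds ((hGfield.smul hE.smooth_velocity).isSmooth_slice hs)
    rwa [h2] at h1
  have hcont : ContinuousOn (fun s => ∫ x, ρ s x * (3 / 2 * Real.log (θ s x) - Real.log (ρ s x) -
      hsExcessFreeEnergy (ρ s x * σ ^ 3))) (Icc 0 t) := fun s hs =>
    ((hderiv s ⟨hs.1, hs.2.trans_lt ht.2⟩).continuousWithinAt).mono (Icc_subset_Ico_right ht.2)
  have hright : ∀ s ∈ Ico 0 t, HasDerivWithinAt (fun s => ∫ x, ρ s x * (3 / 2 * Real.log (θ s x) -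
      Real.log (ρ s x) - hsExcessFreeEnergy (ρ s x * σ ^ 3))) 0 (Ici s) s := by
    intro s hs
    have hsT : s ∈ Ico 0 T := ⟨hs.1, hs.2.trans ht.2⟩
    refine (hderiv s hsT).mono_of_mem_nhdsWithin ?_
    exact Filter.mem_of_superset (Ico_mem_nhdsGE hsT.2) (Ico_subset_Ico_left hsT.1)
  exact constant_of_has_deriv_right_zero hcont hright t (right_mem_Icc.2 ht.1)

end Summit.AtomisticToContinuum.HydrodynamicLimit.Theorems.JaynesSqueezeClosure

end
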